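import Mathlib
import Summits.ValiantsHypothesis.ValiantsHypothesis.Theorems.LacunarySymmetroidMatrixDescartesStubCommutingSector
import Summits.ValiantsHypothesis.ValiantsHypothesis.Theorems.LacunarySymmetroidMatrixDescartesStubDiagonalSector
import Summits.ValiantsHypothesis.ValiantsHypothesis.Theorems.LacunarySymmetroidMatrixDescartesStubVLawTwo

/-!
# Crux `MatrixDescartes` (stmt-ValiantsHypothesis-18050), line `Lift` — stub `stub_commutingTwoSided`

The COMMUTATIVE WORLD of the two-sided pencil never exceeds `2m` positive zeros: for a real
symmetric pivot `J`, positive semidefinite `P₀, …, P_{K-1}` (all `m × m`) such that `J` commutes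
with every `Pₖ` and the `Pₖ` commute pairwise, and arbitrary exponents `e, d₀, …, d_{K-1}`, the
pencil determinant `det (X^e J + ∑ₖ X^{dₖ} Pₖ)` has at most `2m` distinct positive real zeros.

Proof.
* Package the family as `S := Fin.cons J P : Fin (K+1) → _` with exponents `Fin.cons e d`; it is
  termwise symmetric (`Matrix.isHermitian_iff_isSymm` for the `Pₖ`) and pairwise commuting, so the
  landed commuting sector gives a joint eigenmatrix `U` (invertible, `Sₗ U = U diag (γ l)`,
  `StubCommutingSector.exists_jointEigenmatrix`) and the determinant of the pencil equals that of
  the diagonal pencil (`StubCommutingSector.det_pencil_eq_of_intertwine`), i.e. the product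
  `∏ᵢ fᵢ` with `fᵢ = ∑ₗ γ l i · X^{dₗ'}` (`StubDiagonalSector.pencil_eq_diagonal`, `Matrix.det_diagonal`).
* NONNEGATIVITY (`StubCommutingTwoSided.diag_nonneg_of_posSemidef`): the `i`-th column `u` of `U`
  is nonzero (`det U ≠ 0`) and `Pₖ u = γ u`, so `γ ‖u‖² = uᵀ Pₖ u ≥ 0` forces `γ ≥ 0`.  Hence every
  coefficient of `fᵢ` off the exponent `e` is a sum of nonnegative reals.
* DESCARTES (`StubCommutingTwoSided.signVariations_le_two_of_coeff_nonneg_off`): a real polynomial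
  all of whose coefficients are nonnegative except possibly the one at `X^e` has at most two sign
  variations (peel leading terms with `Polynomial.signVariations_eq_eraseLead_add_ite`: a variation
  can only be created when the next leading coefficient is the negative one at `e`, after which at
  most one more variation remains).  By `Polynomial.roots_countP_pos_le_signVariations` each factor
  has at most two distinct positive zeros.
* PRODUCT (`StubCommutingTwoSided.card_posRoots_prod_le_two_mul`): a positive zero of a nonzero
  product is one of some factor, so at most `2m` in total; the zero polynomial has no roots counted.

Mathlib + the tree's commuting / diagonal sectors and `StubVLawTwo.card_filter_pos_le_countP`
(axioms `propext`, `Classical.choice`, `Quot.sound`).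
-/

-- layout Summits/ValiantsHypothesis/ValiantsHypothesis forces the duplicated namespace component
set_option linter.dupNamespace false

namespace Summit.ValiantsHypothesis.ValiantsHypothesis.Theorems.LacunarySymmetroidMatrixDescartes

open Polynomial Matrix Finset
open scoped BigOperators

namespace StubCommutingTwoSided

/-! ### Descartes bookkeeping: one possibly negative coefficient gives at most two variations -/

/-- A real polynomial with nonnegative coefficients has no sign variations (induction on the
number of monomials, erasing the leading term: two nonnegative leading signs never alternate). -/
theorem signVariations_eq_zero_of_coeff_nonneg :
    ∀ g : ℝ[X], (∀ n, 0 ≤ g.coeff n) → g.signVariations = 0 := by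
  intro g
  induction h : g.support.card using Nat.strong_induction_on generalizing g with
  | _ N ih =>
    intro hg
    by_cases hg0 : g = 0
    · rw [hg0, signVariations_zero]
    have hE : ∀ n, 0 ≤ g.eraseLead.coeff n := fun n => by
      rw [eraseLead_coeff]
      split_ifs
      · exact le_rfl
      · exact hg n
    have hlc : 0 < g.leadingCoeff :=
      lt_of_le_of_ne (hg _) (Ne.symm (leadingCoeff_ne_zero.mpr hg0))
    have hEl : 0 ≤ g.eraseLead.leadingCoeff := hE _
    rw [signVariations_eq_eraseLead_add_ite hg0,
      ih _ (h ▸ eraseLead_support_card_lt hg0) g.eraseLead rfl hE, zero_add, sign_pos hlc, if_neg]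
    rcases hEl.eq_or_lt with h0 | hpos
    · rw [← h0, sign_zero, neg_zero]
      decide
    · rw [sign_pos hpos]
      decide

/-- If all coefficients off the exponent `e` are nonnegative and the degree is at most `e`, there
is at most one sign variation: erasing the leading term leaves nonnegative coefficients only. -/
theorem signVariations_le_one_of_natDegree_le (f : ℝ[X]) (e : ℕ) (hf : ∀ n ≠ e, 0 ≤ f.coeff n)
    (hd : f.natDegree ≤ e) : f.signVariations ≤ 1 := by
  have hE : ∀ n, 0 ≤ f.eraseLead.coeff n := fun n => by
    rw [eraseLead_coeff]
    split_ifs with hn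
    · exact le_rfl
    · by_cases hne : n = e
      · rw [hne] at hn ⊢
        rw [coeff_eq_zero_of_natDegree_lt (lt_of_le_of_ne hd (Ne.symm hn))]
      · exact hf n hne
  calc f.signVariations ≤ f.eraseLead.signVariations + 1 := signVariations_le_eraseLead_succ f
    _ = 1 := by rw [signVariations_eq_zero_of_coeff_nonneg _ hE]

/-- **One odd coefficient, at most two variations.**  A real polynomial all of whose coefficients
are nonnegative except possibly the coefficient of `X^e` has at most two sign variations: its sign
pattern from the top is `(+,…,+, sₑ, +,…,+)`.  Induction on the number of monomials: while the
degree exceeds `e` the leading sign is `+`, and erasing it creates a variation only when the next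
leading coefficient is the (negative) one at `e`, where `signVariations_le_one_of_natDegree_le`
takes over. -/
theorem signVariations_le_two_of_coeff_nonneg_off (e : ℕ) :
    ∀ f : ℝ[X], (∀ n ≠ e, 0 ≤ f.coeff n) → f.signVariations ≤ 2 := by
  intro f
  induction h : f.support.card using Nat.strong_induction_on generalizing f with
  | _ N ih =>
    intro hf
    by_cases hf0 : f = 0
    · rw [hf0, signVariations_zero]
      exact Nat.zero_le _
    by_cases hd : f.natDegree ≤ e
    · exact (signVariations_le_one_of_natDegree_le f e hf hd).trans one_le_two
    rw [not_le] at hd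
    have hlc : 0 < f.leadingCoeff :=
      lt_of_le_of_ne (hf _ hd.ne') (Ne.symm (leadingCoeff_ne_zero.mpr hf0))
    have hE : ∀ n ≠ e, 0 ≤ f.eraseLead.coeff n := fun n hn => by
      rw [eraseLead_coeff]
      split_ifs
      · exact le_rfl
      · exact hf n hn
    rw [signVariations_eq_eraseLead_add_ite hf0, sign_pos hlc]
    split_ifs with hs
    · -- the next leading coefficient is negative, hence it is the coefficient at `e`
      have hneg : f.eraseLead.leadingCoeff < 0 := by
        rcases lt_trichotomy f.eraseLead.leadingCoeff 0 with hlt | heq | hgt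
        · exact hlt
        · rw [heq, sign_zero, neg_zero] at hs
          exact absurd hs (by decide)
        · rw [sign_pos hgt] at hs
          exact absurd hs (by decide)
      have hde : f.eraseLead.natDegree = e := by
        by_contra hne
        have h0 : 0 ≤ f.eraseLead.leadingCoeff := hE _ hne
        exact absurd hneg (not_lt.mpr h0)
      have h1 := signVariations_le_one_of_natDegree_le f.eraseLead e hE hde.le
      omega
    · rw [add_zero]
      exact ih _ (h ▸ eraseLead_support_card_lt hf0) f.eraseLead rfl hE

/-! ### Eigenvalues of positive semidefinite matrices along a joint eigenmatrix -/

/-- If `P ⪰ 0` and `P U = U (diagonal γ)` with `U` invertible, every `γ i` is nonnegative: the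
`i`-th column `u` of `U` is a nonzero vector with `P u = γ i • u`, so `γ i ‖u‖² = uᵀ P u ≥ 0`. -/
theorem diag_nonneg_of_posSemidef {m : ℕ} {P U : Matrix (Fin m) (Fin m) ℝ} {γ : Fin m → ℝ}
    (hP : P.PosSemidef) (hU : IsUnit U) (h : P * U = U * Matrix.diagonal γ) (i : Fin m) :
    0 ≤ γ i := by
  have hu : Uᵀ i ≠ 0 := fun hu0 =>
    ((Matrix.isUnit_iff_isUnit_det U).mp hU).ne_zero
      (Matrix.det_eq_zero_of_column_eq_zero i fun j => congrFun hu0 j)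
  have hPu : P *ᵥ Uᵀ i = γ i • Uᵀ i := by
    funext j
    have hj := congrFun (congrFun h j) i
    rw [Matrix.mul_apply, Matrix.mul_diagonal] at hj
    simp only [Matrix.mulVec, dotProduct, Matrix.transpose_apply, Pi.smul_apply, smul_eq_mul]
    rw [hj, mul_comm]
  have h1 : 0 ≤ γ i * (Uᵀ i ⬝ᵥ Uᵀ i) := by
    have := hP.dotProduct_mulVec_nonneg (Uᵀ i)
    rwa [star_trivial, hPu, dotProduct_smul, smul_eq_mul] at this
  have h2 : 0 < Uᵀ i ⬝ᵥ Uᵀ i := by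
    have := Matrix.dotProduct_star_self_pos_iff.mpr hu
    rwa [star_trivial] at this
  exact (mul_nonneg_iff_of_pos_right h2).mp h1

/-! ### Products and the packaged pencil -/

/-- A product of `m` real polynomials, each with at most two distinct positive zeros, has at most
`2m` distinct positive zeros: if the product vanishes no root is counted, otherwise a positive zero
of the product is a positive zero of some factor. -/
theorem card_posRoots_prod_le_two_mul (m : ℕ) (p : Fin m → ℝ[X])
    (hp : ∀ i, ((p i).roots.toFinset.filter (fun t => 0 < t)).card ≤ 2) :
    ((∏ i, p i).roots.toFinset.filter (fun t => 0 < t)).card ≤ 2 * m := by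
  by_cases hP : ∏ i, p i = 0
  · rw [hP, Polynomial.roots_zero, Multiset.toFinset_zero, filter_empty, card_empty]
    exact Nat.zero_le _
  · have hpi : ∀ i, p i ≠ 0 := fun i h => hP (prod_eq_zero (mem_univ i) h)
    -- positive zeros of the product are positive zeros of some factor
    have hsub : (∏ i, p i).roots.toFinset.filter (fun t => 0 < t) ⊆
        univ.biUnion fun i => (p i).roots.toFinset.filter (fun t => 0 < t) := by
      intro x hx
      simp only [mem_filter, Multiset.mem_toFinset, mem_roots hP, IsRoot.def, eval_prod,
        prod_eq_zero_iff] at hx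
      obtain ⟨⟨i, -, hix⟩, hx0⟩ := hx
      simp only [mem_biUnion, mem_filter, Multiset.mem_toFinset]
      exact ⟨i, mem_univ i, (mem_roots (hpi i)).mpr (IsRoot.def.mpr hix), hx0⟩
    calc ((∏ i, p i).roots.toFinset.filter (fun t => 0 < t)).card
        ≤ (univ.biUnion fun i => (p i).roots.toFinset.filter (fun t => 0 < t)).card :=
          card_le_card hsub
      _ ≤ ∑ i, ((p i).roots.toFinset.filter (fun t => 0 < t)).card := card_biUnion_le
      _ ≤ ∑ _i : Fin m, 2 := sum_le_sum fun i _ => hp i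
      _ = 2 * m := by simp [mul_comm]

/-- The packaged statement: for a pairwise commuting family of real symmetric matrices
`S₀, …, S_K` in which every `Sₗ` with `l ≠ 0` is positive semidefinite, the pencil
`det (∑ₗ X^{dₗ} Sₗ)` has at most `2m` distinct positive zeros (joint eigenmatrix, diagonal pencil,
nonnegative eigenvalues off the pivot, Descartes factor by factor). -/
theorem card_posRoots_pencil_le {K m : ℕ} (d : Fin (K + 1) → ℕ)
    (S : Fin (K + 1) → Matrix (Fin m) (Fin m) ℝ) (hS : ∀ l, (S l).IsSymm)
    (hcomm : ∀ l l', S l * S l' = S l' * S l) (hpos : ∀ k : Fin K, (S k.succ).PosSemidef) :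
    ((Matrix.det (∑ l, ((Polynomial.X : Polynomial ℝ) ^ d l) • (S l).map Polynomial.C)).roots.toFinset.filter
        (fun t => 0 < t)).card ≤ 2 * m := by
  obtain ⟨U, γ, hU, hSU⟩ := StubCommutingSector.exists_jointEigenmatrix S hS hcomm
  have hγ : ∀ (k : Fin K) (i : Fin m), 0 ≤ γ k.succ i := fun k i =>
    diag_nonneg_of_posSemidef (hpos k) hU (hSU k.succ) i
  rw [StubCommutingSector.det_pencil_eq_of_intertwine d S (fun l => Matrix.diagonal (γ l)) U
    hU hSU, StubDiagonalSector.pencil_eq_diagonal, Matrix.det_diagonal]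
  refine card_posRoots_prod_le_two_mul m _ fun i => ?_
  refine (StubVLawTwo.card_filter_pos_le_countP _).trans
    ((roots_countP_pos_le_signVariations _).trans
      (signVariations_le_two_of_coeff_nonneg_off (d 0) _ fun n hn => ?_))
  rw [finsetSum_coeff, Fin.sum_univ_succ]
  simp only [coeff_C_mul_X_pow, if_neg hn, zero_add]
  exact sum_nonneg fun k _ => by
    split_ifs
    · exact hγ k i
    · exact le_rfl

end StubCommutingTwoSided

/-- **Registered stub `stub_commutingTwoSided`** (the commutative world of the two-sided pencil):
if the symmetric pivot `J` commutes with every `Pₖ ⪰ 0` and the `Pₖ` commute pairwise, then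
`det (X^e J + ∑ₖ X^{dₖ} Pₖ)` has at most `2m` distinct positive zeros, for every `K` and all
exponents.  Package `(J, P)` as `Fin.cons J P` and apply
`StubCommutingTwoSided.card_posRoots_pencil_le` (simultaneous diagonalisation, nonnegative
eigenvalues of the `Pₖ`, and "one odd coefficient gives at most two sign variations"). -/
theorem stub_commutingTwoSided (K m e : ℕ) (d : Fin K → ℕ) (J : Matrix (Fin m) (Fin m) ℝ)
    (P : Fin K → Matrix (Fin m) (Fin m) ℝ) (hJ : J.IsSymm) (hP : ∀ k, (P k).PosSemidef)
    (hJP : ∀ k, J * P k = P k * J) (hPP : ∀ k k', P k * P k' = P k' * P k) :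
    ((Matrix.det (((Polynomial.X : Polynomial ℝ) ^ e) • J.map Polynomial.C
        + ∑ k, ((Polynomial.X : Polynomial ℝ) ^ d k) • (P k).map Polynomial.C)).roots.toFinset.filter
          (fun t => 0 < t)).card ≤ 2 * m := by
  have hS : ∀ l, (Fin.cons (α := fun _ => Matrix (Fin m) (Fin m) ℝ) J P l).IsSymm := by
    refine Fin.forall_fin_succ.mpr ⟨?_, fun k => ?_⟩
    · simpa only [Fin.cons_zero] using hJ
    · simpa only [Fin.cons_succ] using Matrix.isHermitian_iff_isSymm.mp (hP k).1
  have hcomm : ∀ l l', Fin.cons (α := fun _ => Matrix (Fin m) (Fin m) ℝ) J P l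
      * Fin.cons (α := fun _ => Matrix (Fin m) (Fin m) ℝ) J P l'
        = Fin.cons (α := fun _ => Matrix (Fin m) (Fin m) ℝ) J P l'
          * Fin.cons (α := fun _ => Matrix (Fin m) (Fin m) ℝ) J P l := by
    refine Fin.forall_fin_succ.mpr ⟨Fin.forall_fin_succ.mpr ⟨rfl, fun k' => ?_⟩,
      fun k => Fin.forall_fin_succ.mpr ⟨?_, fun k' => ?_⟩⟩
    · simpa only [Fin.cons_zero, Fin.cons_succ] using hJP k'
    · simpa only [Fin.cons_zero, Fin.cons_succ] using (hJP k).symm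
    · simpa only [Fin.cons_succ] using hPP k k'
  have hpos : ∀ k : Fin K,
      (Fin.cons (α := fun _ => Matrix (Fin m) (Fin m) ℝ) J P k.succ).PosSemidef := fun k => by
    simpa only [Fin.cons_succ] using hP k
  have h := StubCommutingTwoSided.card_posRoots_pencil_le
    (Fin.cons (α := fun _ => ℕ) e d) _ hS hcomm hpos
  simpa only [Fin.sum_univ_succ, Fin.cons_zero, Fin.cons_succ] using h

end Summit.ValiantsHypothesis.ValiantsHypothesis.Theorems.LacunarySymmetroidMatrixDescartes
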